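import Summits.Ventures.PackingBounds.Configurations.G14Vectors
import Summits.Ventures.PackingBounds.Kissing.DimensionFourteen

/-!
# Ganzhinov's kissing configuration in dimension `14`, II: `κ(14) ≥ 1932` in Lean

Framing: lottery ticket; floor = certified bounds/negative ranges. Venture `PackingBounds` (cell
`pub-packcert`, seat `pub-packcert-energy`).

With the `210` base vectors `vec t` (cells `0–6`) / `vec' t` (cells `7–13`) of `G14Vectors.lean`, the integer model
(scale `2√2`, norm `8`) of Ganzhinov's configuration is
`conf = {vec t + vec' t′ : t, t′ < 126, frameOf t = frameOf t′} ∪ {vec d, vec' d : 126 ≤ d < 210} ⊂ ℤ²⁴`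
(`9 · 14 · 14 + 2 · 84 = 1764 + 168 = 1932` vectors: `Φ₃ ∪ (1±i)/√2 Φ₂` and `Φ₄ ∪ iΦ₄`). All counting, norm and
inner-product statements reduce by bilinearity to the kernel-checked `ipv` facts: pairwise `ip ≤ 4`, i.e. inner
products `≤ 1/2` after normalisation, and the configuration lies in `{y₁₄ = ⋯ = y₂₃ = 0}`; transfer to `ℝ¹⁴` gives
**`κ(14) ≥ 1932`** (`exists_kissing_1932`) — the record lower bound in dimension `14` at the time of writing
(previously `1606`; the cell's `P14b.lean` has the older `1582`) — and the bracket `1932 ≤ κ(14) ≤ 3492` with the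
cell's kernel-checked Delsarte certificate (in print `κ(14) ≤ 3177`).

## References
* M. Ganzhinov, *Highly symmetric lines*, arXiv:2207.08266, §5.5 and Table 2; Linear Algebra Appl. 722 (2025) 12–37. [`Ganzhinov2022`]
-/

namespace Summit.Ventures.PackingBounds.Config.G14

open Finset Leech Golay CL17

/-! ### Index sets -/

/-- Ordered pairs of `E₇` indices in the same frame. -/
def idxE : Finset (ℕ × ℕ) := ((range 126) ×ˢ (range 126)).filter fun q => frameOf q.1 = frameOf q.2

/-- `D₇` indices with a block flag (`true`: cells `0–6`, `false`: cells `7–13`). -/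
def idxD : Finset (ℕ × Bool) := (Ico 126 210) ×ˢ univ

set_option maxRecDepth 100000 in
/-- Kernel count: `9` frames of `14` vectors give `9 · 14² = 1764` same-frame pairs. -/
theorem card_idxE : idxE.card = 1764 := by decide +kernel

/-- Membership in `idxE`. -/
theorem mem_idxE {q : ℕ × ℕ} : q ∈ idxE ↔ q.1 < 126 ∧ q.2 < 126 ∧ frameOf q.1 = frameOf q.2 := by
  simp [idxE, and_assoc]

/-- `|idxD| = 168`. -/
theorem card_idxD : idxD.card = 168 := by simp [idxD]

/-- Membership in `idxD`. -/
theorem mem_idxD {q : ℕ × Bool} : q ∈ idxD ↔ 126 ≤ q.1 ∧ q.1 < 210 := by simp [idxD]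

attribute [irreducible] idxE idxD

/-! ### The configuration -/

/-- The same-frame pairs `(u, u′)`: `Φ₃ ∪ (1+i)/√2 Φ₂ ∪ (1−i)/√2 Φ₂`, scaled by `2√2`. [cite: Ganzhinov2022, §5.5] -/
noncomputable def confE : Finset (Fin 24 → ℤ) := idxE.image fun q => vec q.1 + vec' q.2

/-- The `D₇` vectors on either block: `Φ₄ ∪ i Φ₄`, scaled by `2√2`. [cite: Ganzhinov2022, §5.5] -/
noncomputable def confD : Finset (Fin 24 → ℤ) := idxD.image fun q => bif q.2 then vec q.1 else vec' q.1

/-- **Ganzhinov's `14`-dimensional kissing configuration** (integer model in `ℤ²⁴`, norm `8`). [cite: Ganzhinov2022, §5.5] -/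
noncomputable def conf : Finset (Fin 24 → ℤ) := confE ∪ confD

/-- Members of `confE`. -/
theorem mem_confE {z : Fin 24 → ℤ} (hz : z ∈ confE) :
    ∃ t t', t < 126 ∧ t' < 126 ∧ frameOf t = frameOf t' ∧ z = vec t + vec' t' := by
  obtain ⟨q, hq, rfl⟩ := mem_image.mp hz
  obtain ⟨h1, h2, h3⟩ := mem_idxE.mp hq
  exact ⟨q.1, q.2, h1, h2, h3, rfl⟩

/-- Members of `confD`. -/
theorem mem_confD {z : Fin 24 → ℤ} (hz : z ∈ confD) : ∃ d, 126 ≤ d ∧ d < 210 ∧ (z = vec d ∨ z = vec' d) := by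
  obtain ⟨q, hq, rfl⟩ := mem_image.mp hz
  obtain ⟨h1, h2⟩ := mem_idxD.mp hq
  refine ⟨q.1, h1, h2, ?_⟩
  cases q.2
  · exact Or.inr rfl
  · exact Or.inl rfl

/-! ### Inner products by bilinearity -/

/-- A pair vector against a first-block base vector. -/
theorem ip_pair_vec {t t' u : ℕ} (ht : t < 210) (ht' : t' < 210) (hu : u < 210) :
    ip (vec t + vec' t') (vec u) = ipv t u := by
  rw [ip_add_left, ip_vec_vec ht hu, ip_vec'_vec ht' hu, add_zero]

/-- A pair vector against a second-block base vector. -/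
theorem ip_pair_vec' {t t' u : ℕ} (ht : t < 210) (ht' : t' < 210) (hu : u < 210) :
    ip (vec t + vec' t') (vec' u) = ipv t' u := by
  rw [ip_add_left, ip_vec_vec' ht hu, ip_vec'_vec' ht' hu, zero_add]

/-- Two pair vectors. -/
theorem ip_pair_pair {t t' u u' : ℕ} (ht : t < 210) (ht' : t' < 210) (hu : u < 210) (hu' : u' < 210) :
    ip (vec t + vec' t') (vec u + vec' u') = ipv t u + ipv t' u' := by
  rw [ip_add_right, ip_pair_vec ht ht' hu, ip_pair_vec' ht ht' hu']

/-- `ipv = 4` forces equality of `E₇` indices. -/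
theorem eq_of_ipv_eq_four {a b : ℕ} (ha : a < 126) (hb : b < 126) (h : ipv a b = 4) : a = b := by
  by_contra hne; have := ipv_le_two ha hb hne; omega

/-- `ipv = 8` forces equality of `D₇` indices. -/
theorem eq_of_ipv_eq_eight {d d' : ℕ} (hd : 126 ≤ d) (hdl : d < 210) (hd' : 126 ≤ d') (hdl' : d' < 210)
    (h : ipv d d' = 8) : d = d' := by
  by_contra hne; have := ipv_D7_le hd hdl hd' hdl' hne; omega

/-! ### Counting: `1764 + 168 = 1932` -/

/-- `|confE| = 1764`. -/
theorem card_confE : confE.card = 1764 := by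
  rw [confE, card_image_of_injOn, card_idxE]
  rintro ⟨t, t'⟩ hq ⟨u, u'⟩ hr h
  obtain ⟨ht, ht', -⟩ := mem_idxE.mp hq
  obtain ⟨hu, hu', -⟩ := mem_idxE.mp hr
  dsimp only at ht ht' hu hu'
  change vec t + vec' t' = vec u + vec' u' at h
  have h1 : ipv u t = 4 := by
    have e := congrArg (fun z => ip z (vec t)) h
    rw [ip_pair_vec (by omega) (by omega) (by omega), ip_pair_vec (by omega) (by omega) (by omega),
      ipv_self t (by omega), if_pos ht] at e
    exact e.symm
  have h2 : ipv u' t' = 4 := by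
    have e := congrArg (fun z => ip z (vec' t')) h
    rw [ip_pair_vec' (by omega) (by omega) (by omega), ip_pair_vec' (by omega) (by omega) (by omega),
      ipv_self t' (by omega), if_pos ht'] at e
    exact e.symm
  rw [eq_of_ipv_eq_four hu ht h1, eq_of_ipv_eq_four hu' ht' h2]

/-- `|confD| = 168`. -/
theorem card_confD : confD.card = 168 := by
  rw [confD, card_image_of_injOn, card_idxD]
  rintro ⟨d, b⟩ hq ⟨d', b'⟩ hr h
  obtain ⟨hd, hdl⟩ := mem_idxD.mp hq
  obtain ⟨hd', hdl'⟩ := mem_idxD.mp hr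
  dsimp only at hd hdl hd' hdl'
  have h8 := ipv_self d (by omega)
  rw [if_neg (by omega)] at h8
  cases b <;> cases b' <;> simp only [cond_true, cond_false] at h
  · have e := congrArg (fun z => ip z (vec' d)) h
    rw [ip_vec'_vec' (by omega) (by omega), ip_vec'_vec' (by omega) (by omega), h8] at e
    rw [eq_of_ipv_eq_eight hd' hdl' hd hdl e.symm]
  · have e := congrArg (fun z => ip z (vec' d)) h
    rw [ip_vec'_vec' (by omega) (by omega), ip_vec_vec' (by omega) (by omega), h8] at e
    norm_num at e
  · have e := congrArg (fun z => ip z (vec d)) h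
    rw [ip_vec_vec (by omega) (by omega), ip_vec'_vec (by omega) (by omega), h8] at e
    norm_num at e
  · have e := congrArg (fun z => ip z (vec d)) h
    rw [ip_vec_vec (by omega) (by omega), ip_vec_vec (by omega) (by omega), h8] at e
    rw [eq_of_ipv_eq_eight hd' hdl' hd hdl e.symm]

/-- The two parts are disjoint (a pair vector has `ip ≤ 4` with every `D₇` vector, which has norm `8`). -/
theorem disjoint_confE_confD : Disjoint confE confD := by
  rw [Finset.disjoint_left]
  intro z hzE hzD
  obtain ⟨t, t', ht, ht', -, rfl⟩ := mem_confE hzE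
  obtain ⟨d, hd, hdl, h | h⟩ := mem_confD hzD
  · have e := congrArg (fun z => ip z (vec d)) h
    rw [ip_pair_vec (by omega) (by omega) hdl, ip_vec_vec hdl hdl, ipv_self d hdl, if_neg (by omega)] at e
    have := ipv_E7_D7_le ht hd hdl; omega
  · have e := congrArg (fun z => ip z (vec' d)) h
    rw [ip_pair_vec' (by omega) (by omega) hdl, ip_vec'_vec' hdl hdl, ipv_self d hdl, if_neg (by omega)] at e
    have := ipv_E7_D7_le ht' hd hdl; omega

/-- **`|conf| = 1932`.** -/
theorem card_conf : conf.card = 1932 := by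
  rw [conf, card_union_of_disjoint disjoint_confE_confD, card_confE, card_confD]

/-! ### Norms and pairwise inner products -/

/-- Every vector of `conf` has norm `8` and vanishes beyond cell `13`. -/
theorem norm_and_tail_of_mem_conf {z : Fin 24 → ℤ} (hz : z ∈ conf) :
    ip z z = 8 ∧ ∀ j : Fin 24, 14 ≤ j.val → z j = 0 := by
  rw [conf, mem_union] at hz
  rcases hz with hz | hz
  · obtain ⟨t, t', ht, ht', -, rfl⟩ := mem_confE hz
    refine ⟨?_, fun j hj => ?_⟩
    · rw [ip_pair_pair (by omega) (by omega) (by omega) (by omega), ipv_self t (by omega), ipv_self t' (by omega),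
        if_pos ht, if_pos ht']; rfl
    · obtain ⟨h1, -⟩ := vec_apply_eq_zero (t := t) (by omega) hj
      obtain ⟨-, h2⟩ := vec_apply_eq_zero (t := t') (by omega) hj
      simp [h1, h2]
  · obtain ⟨d, hd, hdl, h | h⟩ := mem_confD hz <;> subst h
    · refine ⟨by rw [ip_vec_vec hdl hdl, ipv_self d hdl, if_neg (by omega)], fun j hj => ?_⟩
      exact (vec_apply_eq_zero hdl hj).1
    · refine ⟨by rw [ip_vec'_vec' hdl hdl, ipv_self d hdl, if_neg (by omega)], fun j hj => ?_⟩
      exact (vec_apply_eq_zero hdl hj).2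

/-- Two distinct pair vectors have `ip ≤ 4`. -/
theorem ip_pair_pair_le {t t' u u' : ℕ} (ht : t < 126) (ht' : t' < 126) (hf : frameOf t = frameOf t')
    (hu : u < 126) (hu' : u' < 126) (hg : frameOf u = frameOf u') (hne : vec t + vec' t' ≠ vec u + vec' u') :
    ip (vec t + vec' t') (vec u + vec' u') ≤ 4 := by
  rw [ip_pair_pair (by omega) (by omega) (by omega) (by omega)]
  by_cases hfr : frameOf t = frameOf u
  · by_cases htu : t = u
    · subst htu
      have htu' : t' ≠ u' := fun h => hne (by rw [h])
      have h1 := ipv_le_zero ht' hu' htu' (hf.symm.trans hg)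
      rw [ipv_self t (by omega), if_pos ht]; omega
    · have h1 := ipv_le_zero ht hu htu hfr
      have h2 := ipv_le_four ht' hu'; omega
  · have htu : t ≠ u := fun h => hfr (by rw [h])
    have htu' : t' ≠ u' := fun h => hfr (by rw [hf, h, hg])
    have h1 := ipv_le_two ht hu htu
    have h2 := ipv_le_two ht' hu' htu'; omega

/-- A pair vector against a `D₇` vector has `ip ≤ 4`. -/
theorem ip_pair_D7_le {t t' d : ℕ} (ht : t < 126) (ht' : t' < 126) (hd : 126 ≤ d) (hdl : d < 210) {y : Fin 24 → ℤ}
    (hy : y = vec d ∨ y = vec' d) : ip (vec t + vec' t') y ≤ 4 := by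
  rcases hy with rfl | rfl
  · rw [ip_pair_vec (by omega) (by omega) hdl]; exact ipv_E7_D7_le ht hd hdl
  · rw [ip_pair_vec' (by omega) (by omega) hdl]; exact ipv_E7_D7_le ht' hd hdl

/-- Two distinct `D₇` vectors of the configuration have `ip ≤ 4`. -/
theorem ip_D7_D7_le {d d' : ℕ} (hd : 126 ≤ d) (hdl : d < 210) (hd' : 126 ≤ d') (hdl' : d' < 210)
    {x y : Fin 24 → ℤ} (hx : x = vec d ∨ x = vec' d) (hy : y = vec d' ∨ y = vec' d') (hne : x ≠ y) : ip x y ≤ 4 := by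
  rcases hx with rfl | rfl <;> rcases hy with rfl | rfl
  · have hdd : d ≠ d' := fun h => hne (by rw [h])
    rw [ip_vec_vec hdl hdl']; exact ipv_D7_le hd hdl hd' hdl' hdd
  · rw [ip_vec_vec' hdl hdl']; norm_num
  · rw [ip_vec'_vec hdl hdl']; norm_num
  · have hdd : d ≠ d' := fun h => hne (by rw [h])
    rw [ip_vec'_vec' hdl hdl']; exact ipv_D7_le hd hdl hd' hdl' hdd

/-- **Pairwise inner products `≤ 4`** (half the norm). -/
theorem ip_le_of_mem_conf {x y : Fin 24 → ℤ} (hx : x ∈ conf) (hy : y ∈ conf) (hne : x ≠ y) : ip x y ≤ 4 := by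
  rw [conf, mem_union] at hx hy
  rcases hx with hx | hx <;> rcases hy with hy | hy
  · obtain ⟨t, t', ht, ht', hf, rfl⟩ := mem_confE hx
    obtain ⟨u, u', hu, hu', hg, rfl⟩ := mem_confE hy
    exact ip_pair_pair_le ht ht' hf hu hu' hg hne
  · obtain ⟨t, t', ht, ht', -, rfl⟩ := mem_confE hx
    obtain ⟨d, hd, hdl, h⟩ := mem_confD hy
    exact ip_pair_D7_le ht ht' hd hdl h
  · obtain ⟨d, hd, hdl, h⟩ := mem_confD hx
    obtain ⟨t, t', ht, ht', -, rfl⟩ := mem_confE hy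
    rw [ip_comm]; exact ip_pair_D7_le ht ht' hd hdl h
  · obtain ⟨d, hd, hdl, h⟩ := mem_confD hx
    obtain ⟨d', hd', hdl', h'⟩ := mem_confD hy
    exact ip_D7_D7_le hd hdl hd' hdl' h h' hne

/-! ### Transfer to `ℝ¹⁴` -/

/-- **`κ(14) ≥ 1932`** (Ganzhinov 2022; the record lower bound in dimension `14` at the time of writing): `1932` unit
vectors of `ℝ¹⁴` with pairwise inner products `≤ 1/2`. [cite: Ganzhinov2022, §5.5, Table 2] -/
theorem exists_kissing_1932 : ∃ C : Finset (EuclideanSpace ℝ (Fin 14)),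
    C.card = 1932 ∧ (∀ x ∈ C, ‖x‖ = 1) ∧ (∀ x ∈ C, ∀ y ∈ C, x ≠ y → inner ℝ x y ≤ 1 / 2) := by
  set K := conf.image (toE 8) with hK
  have hKc : K.card = 1932 := by
    rw [hK, card_image_of_injective _ (toE_injective (by norm_num)), card_conf]
  have hKn : ∀ p ∈ K, ‖p‖ = 1 := by
    intro p hp
    obtain ⟨x, hx, rfl⟩ := mem_image.mp hp
    exact norm_toE (by norm_num) (by rw [(norm_and_tail_of_mem_conf hx).1]; norm_num)
  have hKi : ∀ p ∈ K, ∀ q ∈ K, p ≠ q → inner ℝ p q ≤ 1 / 2 := by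
    intro p hp q hq hpq
    obtain ⟨x, hx, rfl⟩ := mem_image.mp hp
    obtain ⟨y, hy, rfl⟩ := mem_image.mp hq
    have hxy : x ≠ y := fun h => hpq (by rw [h])
    rw [inner_toE (by norm_num), div_le_iff₀ (by norm_num)]
    have h : (ip x y : ℝ) ≤ 4 := by exact_mod_cast ip_le_of_mem_conf hx hy hxy
    linarith
  have hKo : ∀ p ∈ K, ∀ i : Fin 10,
      inner ℝ (EuclideanSpace.single (⟨14 + i.val, by omega⟩ : Fin 24) (1 : ℝ)) p = 0 := by
    intro p hp i
    obtain ⟨x, hx, rfl⟩ := mem_image.mp hp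
    rw [EuclideanSpace.inner_single_left, map_one, one_mul, toE_apply,
      (norm_and_tail_of_mem_conf hx).2 ⟨14 + i.val, by omega⟩ (by simp)]
    simp
  obtain ⟨C', hc, hno, hi, _⟩ := exists_transfer_orthogonal (m := 24) (n := 14) (k := 10) (by norm_num)
    (fun i : Fin 10 => EuclideanSpace.single (⟨14 + i.val, by omega⟩ : Fin 24) (1 : ℝ))
    (linearIndependent_tail 14 10 (by norm_num)) K hKo
  refine ⟨C', by rw [hc, hKc], fun x' hx' => ?_, fun x' hx' y' hy' hne => ?_⟩
  · obtain ⟨x, hx, he⟩ := hno x' hx'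
    rw [he]; exact hKn x hx
  · obtain ⟨x, hx, y, hy, hxy, he⟩ := hi x' hx' y' hy' hne
    rw [he]; exact hKi x hx y hy hxy

/-- **`1932 ≤ κ(14) ≤ 3492` in Lean** (attained: Ganzhinov's configuration; upper: the cell's kernel-checked Delsarte
LP certificate; in print `κ(14) ≤ 3177`). [cite: Ganzhinov2022, Table 2] -/
theorem kissing_dim14_bracket_1932 :
    (∃ C : Finset (EuclideanSpace ℝ (Fin 14)), C.card = 1932 ∧ (∀ x ∈ C, ‖x‖ = 1) ∧
      (∀ x ∈ C, ∀ y ∈ C, x ≠ y → inner ℝ x y ≤ 1 / 2)) ∧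
    ∀ C : Finset (EuclideanSpace ℝ (Fin 14)), (∀ x ∈ C, ‖x‖ = 1) →
      (∀ x ∈ C, ∀ y ∈ C, x ≠ y → inner ℝ x y ≤ 1 / 2) → C.card ≤ 3492 :=
  ⟨exists_kissing_1932, Kissing.kissing_dim14_le_3492⟩

end Summit.Ventures.PackingBounds.Config.G14
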